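import Summits.Ventures.PercRepro.S1CoreLPColoopStep

/-!
# PercRepro — THE DELETION TRANSFER OF THE FLAT BOUNDS (p2, gen 29; SUBCLAIM-S1 §6.10 (xviii)(i))

The `e`-free cells with coloops allowed: without coloops the cell theorem `rls_free_p_n` of `S1FreeCells*`; with a
coloop `e` the coloop step `rls_succ_of_isColoop` on `M ∖ e` — the cell `(p − 1, d)` of the same corank (row 7: the
diagonal `SixFour.rls_six_four_holds`; row 8: the row-7 wrapper) — the flat bounds passing to the deletion. Nothing is
claimed about any row.

* `planes_delete_singleton`, `tens_delete_singleton`, `sparse_delete_singleton`.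
Axioms: standard.
-/

open scoped Matroid

namespace PercRepro

namespace S1

open Set

variable {α : Type}

/-- Deleting a point keeps «planes ≤ 6». -/
theorem planes_delete_singleton (M : Matroid α) (e : α) (hplanes : ∀ P ⊆ M.E, M.eRk P ≤ 3 → P.ncard ≤ 6) :
    ∀ P ⊆ (M ＼ {e}).E, (M ＼ {e}).eRk P ≤ 3 → P.ncard ≤ 6 := by
  intro P hP hr
  rw [Matroid.delete_ground] at hP
  have hnot : e ∉ P := fun h => (hP h).2 (mem_singleton e)
  rw [Matroid.eRk_delete_of_notMem (hP.trans sdiff_subset) hnot] at hr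
  exact hplanes P (hP.trans sdiff_subset) hr

/-- Deleting a point keeps «rank-`4` sets ≤ 10». -/
theorem tens_delete_singleton (M : Matroid α) (e : α) (htens : ∀ X ⊆ M.E, M.eRk X ≤ 4 → X.ncard ≤ 10) :
    ∀ X ⊆ (M ＼ {e}).E, (M ＼ {e}).eRk X ≤ 4 → X.ncard ≤ 10 := by
  intro X hX hr
  rw [Matroid.delete_ground] at hX
  have hnot : e ∉ X := fun h => (hX h).2 (mem_singleton e)
  rw [Matroid.eRk_delete_of_notMem (hX.trans sdiff_subset) hnot] at hr
  exact htens X (hX.trans sdiff_subset) hr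

/-- Deleting a point keeps «rank-`5` sets ≤ 31». -/
theorem sparse_delete_singleton (M : Matroid α) (e : α) (hsparse : ∀ X ⊆ M.E, M.eRk X ≤ 5 → X.ncard ≤ 31) :
    ∀ X ⊆ (M ＼ {e}).E, (M ＼ {e}).eRk X ≤ 5 → X.ncard ≤ 31 := by
  intro X hX hr
  rw [Matroid.delete_ground] at hX
  have hnot : e ∉ X := fun h => (hX h).2 (mem_singleton e)
  rw [Matroid.eRk_delete_of_notMem (hX.trans sdiff_subset) hnot] at hr
  exact hsparse X (hX.trans sdiff_subset) hr

end S1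

end PercRepro
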